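import Literature.Geometry.Riemannian.GurskyViaclovskyPath
import Literature.Geometry.Riemannian.GurskyViaclovskyC1Estimate
import HarnessLib

/-!
# Stub `stub_pathGradient` of line `gv-continuity-path` (crux `EntropyRung.ChangGurskyYang`),
# closed MODULO the gradient estimate along the Weyl-weighted Gursky–Viaclovsky path
# (Gursky–Viaclovsky 2003, Prop. 5; for the `x`-dependent weight: Chen 2005, Thm. 1(a))

STUB 2 of the lead's skeleton of line `gv-continuity-path` (crux stmt-SmoothPoincare4-10834,
`Summit.SmoothPoincare4.SmoothPoincare4.Theses.EntropyRung.ChangGurskyYang`; hypothesis `hGrad` of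
its `pathApriori_of`) is the `C¹` a-priori estimate of the continuity method of Gursky–Viaclovsky
(J. Differential Geom. 63 (2003) 131–154, arXiv:math/0301350, §4, Prop. 5: "Let `u_t` be a `C³`
solution of (path) for some `δ ≤ t ≤ 1`, satisfying `u_t < δ̄`. Then `‖∇u_t‖_{L^∞} < C₁`, where
`C₁` depends only upon `δ̄` and `g`." — proved there by a maximum-principle computation on
`h = |∇u|²` in normal coordinates at a maximum point, differentiating (path) once to trade the
third derivatives, and the algebraic Lemma 2 "`T_{ij}u_{li}u_{lj} + ((1−t)/2)Σ_l T_{ll}u_{ij}u_{ij}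
≥ β Σ_l T_{ll} |∇u|⁴`" ("This was proved in [LiLi2], using the result in [GuanWang1]"), after
which "Since we are assuming `u` is bounded above, the `|∇u|⁴` term dominates, and the proof
proceeds as in [GuanWang1] or [LiLi2]"; the Remark before the proof: "A Harnack inequality was
proved for the conformally invariant equation for `t = 1` in [GuanWang1], and then extended to
`t < 1` in [LiLi2] … (path) has a different right hand side, so the Harnack inequality now depends
on the sup"), read for the WEYL-WEIGHTED path of this line (`GurskyViaclovskyPath.lean`, module
docstring "Dictionary": `P_t(h) = σ₂(A_h) − ¼|W_h|² + (1−t)(2−t)R_h²/6 = q e^{8u}` on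
`h = e^{−2u} g` is, on the background `g`, Gursky–Viaclovsky's (PDE)
`σ₂^{1/2}(g⁻¹A^t_u) = f(x)e^{2u}` with the right-hand side replaced by
`((1/16)|W_g|²_g + (q/4)e^{4u})^{1/2}` — Gursky–Viaclovsky, §1: "The choice of the right hand side
in (PDE) is quite flexible; the key requirement is simply that the exponent is a positive multiple
of `u`"; in the printed proof of Prop. 5 the right side enters only through
`u_m ∂_m(f²e^{4u}) = u_m(∂_m f²)e^{4u} + 4f²e^{4u}|∇u|²`, which for the weighted right side becomes
`u_m ∂_m ψ_W + u_m(∂_m f²)e^{4u} + 4f²e^{4u}|∇u|²`, still `O(|∇u|²)` under `u ≤ δ̄`, dominated by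
the `β Σ T_{ll}|∇u|⁴` term exactly as printed).

For a right-hand side depending on `x` AND `u` the local gradient estimate is S. Chen, *Local
estimates for some fully nonlinear elliptic equations*, IMRN 2005:63 (arXiv:math/0510652),
Thm. 1(a) (quoted in `Literature/Geometry/Riemannian/GurskyViaclovskyC2Estimate.lean`): for
`F(g⁻¹W) = f(x,u) h₀` with `W = ∇²u + a(x) du⊗du + b(x)|∇u|² g + B(x)`, `b < −δ₁`, `a + n b < −δ₂`,
`F` positive, concave, monotone, homogeneous of degree one on its cone, and `u ∈ C⁴` on a geodesic
ball `B_r`, "`sup_{B_{r/2}} (|∇²u| + |∇u|²) ≤ C₁(n, r, ‖a‖_{C²}, ‖b‖_{C²}, ‖B‖_{C²}, ‖g‖_{C³}, h₀,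
δ₁, δ₂, c_sup(r))`", `c_sup` being the supremum along the solution of `f` and its `x`- and
`z`-derivatives up to order two — all bounded in terms of `sup u`, `‖q‖_{C²}` and `‖|W_g|²_g‖_{C²}`
for `f(x,z) = ((1/16)|W_g|²_g(x) + (q(x)/4)e^{4z})^{1/2}` on `{z ≤ C₀}` — and ibid. Cor. 2, which is
literally Gursky–Viaclovsky's equation "`σ_k^{1/k}(t λ(A_{g_u}) + s σ₁(λ(A_{g_u})) g) = f₀(x) e^{2u}`
… `C = C(n, k, r, ‖g‖_{C⁴}, ‖f₀‖_{C²})` but is independent of `t, s` and `inf f₀`".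

None of this (Guan–Wang / Li–Li maximum-principle gradient estimates for `σ_k`-equations) exists in
Mathlib or in the tree. Following the NEED-A-PUBLISHED-FACT rule, this file

* USES the printed estimate, specialised to exactly what the stub consumes, as the named fact
  `Literature.Geometry.Riemannian.gurskyViaclovsky_gradientEstimate_weighted_four`
  (`Literature/Geometry/Riemannian/GurskyViaclovskyC1Estimate.lean`; stated inline by this line —
  without scoped notation and with fully qualified tree names, so that it elaborates under any
  preamble — and relocated there by the gate, p104676);
* PROVES the stub conditionally on it: `stub_pathGradient_of_gradientEstimate` (the registered
  statement of `stub_pathGradient` VERBATIM after the hypothesis), by definitional unfolding.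

So `stub_pathGradient` is exactly `stub_pathGradient_of_gradientEstimate hG` for
`hG : gurskyViaclovsky_gradientEstimate_weighted_four`, and the line is closed at this leaf MODULO
the named fact; with the lead's LANDED `stub_pathHarnack` (oscillation from the gradient bound) and
the tree's `exists_forall_isPathSolution_le` / `IsPathSolution.exists_log_le` (Gursky–Viaclovsky
Props. 3–4) this completes the `C⁰`–`C¹` half of the a-priori package kernel-side.

References: M. J. Gursky, J. A. Viaclovsky, *A fully nonlinear equation on four-manifolds with
positive scalar curvature*, J. Differential Geom. 63 (2003) 131–154, §1 ((PDE)), §4 (Prop. 5,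
Lemma 2), §5 (proof of Thm. 1: "We may then apply Proposition (C1estimate) to obtain a uniform
gradient bound") [GurskyViaclovsky2003]; S. Chen, *Local estimates for some fully nonlinear
elliptic equations*, Int. Math. Res. Not. 2005, no. 63, 3403–3425, Thm. 1(a), Cor. 2 [Chen2005];
P. Guan, G. Wang, *Local estimates for a class of fully nonlinear equations arising from conformal
geometry*, Int. Math. Res. Not. 2003, no. 26, 1413–1432 [GuanWang2003]; A. Li, Y. Y. Li, *On some
conformally invariant fully nonlinear equations*, Comm. Pure Appl. Math. 56 (2003) 1416–1464
[LiLi2003]; S.-Y. A. Chang, M. J. Gursky, P. C. Yang, Publ. Math. IHÉS 98 (2003) 105–143, (1.10)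
[ChangGurskyYang2003].
-/

noncomputable section
open scoped Manifold ContDiff Topology
open Set Filter
open Literature.Geometry.Lorentzian (PseudoRiemannianMetric)
open Literature.Geometry.Lorentzian.PseudoRiemannianMetric
open Literature.Geometry.Riemannian
open Literature.Geometry.Riemannian.GurskyViaclovskyPath

namespace Summit.SmoothPoincare4.SmoothPoincare4.Theorems.GvContinuityPath
set_option linter.dupNamespace false

/-- **STUB 2 of line `gv-continuity-path` (`stub_pathGradient`, verbatim after the hypothesis),
conditional on the gradient estimate `gurskyViaclovsky_gradientEstimate_weighted_four`
(Gursky–Viaclovsky 2003, Prop. 5, along the Weyl-weighted path; Chen 2005, Thm. 1(a) for the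
`x`-dependent weight).** On a closed `(M⁴, g)`, for a smooth positive right side `q`, `δ ≤ 1` and
a level `C₀` there is `C₁ = C₁(M, g, q, δ, C₀)` with `|∇u|²_g = g.gradSq u x ≤ C₁` for every
smooth admissible solution `(h = e^{−2u} g, u)` of `P_t(h) = q e^{8u}` at any `t ∈ [δ, 1]` with
`u ≤ C₀`. Proof: the named fact is this statement with the scoped notations `𝓡 4`, `𝓘(ℝ)`, `∞`
written out, so it closes the stub by definitional unfolding.
[cite: GurskyViaclovsky2003, Prop. 5 (§4)] [cite: Chen2005, Thm. 1(a) and Cor. 2] -/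
theorem stub_pathGradient_of_gradientEstimate :
    gurskyViaclovsky_gradientEstimate_weighted_four →
    ∀ (M : Type) [TopologicalSpace M] [T2Space M] [SecondCountableTopology M]
      [ChartedSpace (EuclideanSpace ℝ (Fin 4)) M] [IsManifold (𝓡 4) ∞ M] [CompactSpace M]
      (g : PseudoRiemannianMetric (𝓡 4) ∞ (EuclideanSpace ℝ (Fin 4)) (TangentSpace (𝓡 4) : M → Type _))
      [g.HasLeviCivita], g.IsRiemannian →
      ∀ (q : M → ℝ) (δ C₀ : ℝ), ContMDiff (𝓡 4) 𝓘(ℝ) ∞ q → (∀ x, 0 < q x) → δ ≤ 1 →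
      ∃ C₁ : ℝ, ∀ t : ℝ, δ ≤ t → t ≤ 1 →
        ∀ (h : PseudoRiemannianMetric (𝓡 4) ∞ (EuclideanSpace ℝ (Fin 4)) (TangentSpace (𝓡 4) : M → Type _))
          [h.HasLeviCivita] (u : M → ℝ), IsPathSolution g h u t q → (∀ x, u x ≤ C₀) →
          ∀ x, g.gradSq u x ≤ C₁ :=
  fun hG ↦ hG

end Summit.SmoothPoincare4.SmoothPoincare4.Theorems.GvContinuityPath
end
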